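import Literature.AlgebraicGeometry.Resolution.AlterationsSemiStableResolution
import Literature.AlgebraicGeometry.Resolution.StrictNormalCrossingsPoints
import Mathlib.AlgebraicGeometry.Limits
import Mathlib.AlgebraicGeometry.Morphisms.FiniteType
import HarnessLib

/-!
# Normal crossings divisors: locality for open immersions, coproducts, and the pointwise
(Stacks 0BSF) form of de Jong's definition

Topic: `Literature/AlgebraicGeometry/Resolution`. Glue for the node
`DeJong1996FormalNormalCrossings` (`AlterationsNormalFormBlowup.lean`; de Jong 1996, between
4.25 (i), 4.27 and 4.28/2.4): de Jong's normal crossings divisors (2.4: "there is a surjective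
étale morphism `S' → S` such that the inverse image of `D` is a strict normal crossings divisor
on `S'`", `IsNormalCrossingsDivisor`) versus the pointwise definition of the Stacks Project
(Tag 0BSF: "for every `p ∈ D` there exists an étale morphism `U → X` with `p` in the image and
`D ×_X U` a strict normal crossings divisor on `U`"). The two agree: given étale neighbourhoods
pointwise, their coproduct together with the open complement of the divisor is a surjective
étale cover on which the preimage is a strict normal crossings divisor. This file PROVES

* `comap_vanishingIdeal_of_isOpenImmersion`, `stalkIdeal_comap_of_isOpenImmersion` — the ideal
  sheaf of the reduced closed subscheme on a closed `Z ⊆ X` pulls back along an open immersion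
  `j : U → X` to that of `j⁻¹ Z`, and stalks of pulled-back ideal sheaves along open immersions;
* `IsStrictNormalCrossingsDivisor.of_forall_exists_isOpenImmersion` — the local form of a strict
  normal crossings divisor (de Jong 2.4 / Stacks 0BI9, `IsStrictNormalCrossingsDivisor`) may be
  checked on an open cover (by open immersions `U → X`); `IsStrictNormalCrossingsDivisor.sigmaDesc`
  — hence on the summands of a coproduct `∐ Uᵢ → X`;
* `IsNormalCrossingsDivisor.of_forall_exists_etale` — **Stacks 0BSF ⇒ de Jong 2.4**: if every
  point of the closed `Z` lies in the image of an étale `U → X` pulling `Z` back to a strict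
  normal crossings divisor, then `Z` is a normal crossings divisor;
* `IsNormalCrossingsDivisor.of_forall_closedPoints_exists_etale` — on a Jacobson scheme (e.g.
  locally of finite type over a field) it suffices to provide such étale neighbourhoods at the
  CLOSED points of `Z`: their (open) images then cover `Z`.

## Sources

* A. J. de Jong, *Smoothness, semi-stability and alterations*, Publ. Math. IHÉS 83 (1996), 2.4
  (p. 55).
* The Stacks Project, Tags 0BI9, 0BSF (strict / normal crossings divisors), 01J3 (reduced
  induced closed subscheme).
-/

noncomputable section

open CategoryTheory CategoryTheory.Limits AlgebraicGeometry TopologicalSpace IsLocalRing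

universe u

namespace Literature.AlgebraicGeometry.Resolution

open Scheme.IdealSheafData

variable {U X : Scheme.{u}}

/-! ## Vanishing ideals and their stalks along open immersions -/

/-- The ideal sheaf of the reduced closed subscheme on a closed subset is radical. [folklore] -/
theorem radical_vanishingIdeal (Z : Closeds X) : (vanishingIdeal Z).radical = vanishingIdeal Z := by
  apply Scheme.IdealSheafData.ext
  funext V
  rw [radical_ideal, vanishingIdeal_ideal]
  exact (PrimeSpectrum.isRadical_vanishingIdeal _).radical

/-- A radical ideal sheaf is the vanishing ideal sheaf of its support (Stacks 01J3: the reduced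
closed subscheme on a closed subset is unique). [folklore] -/
theorem eq_vanishingIdeal_of_radical {I : X.IdealSheafData} (hrad : I.radical = I) {Z : Closeds X}
    (hZ : I.support = Z) : I = vanishingIdeal Z := by
  rw [← hZ, vanishingIdeal_support, hrad]

/-- **The reduced structure pulls back along open immersions**: for an open immersion
`j : U → X` and a closed `Z ⊆ X`, the pull-back of the ideal sheaf of (the reduced closed
subscheme on) `Z` is the ideal sheaf of `j⁻¹ Z` — it is radical with support `j⁻¹ Z`.
[folklore] -/
theorem comap_vanishingIdeal_of_isOpenImmersion (j : U ⟶ X) [IsOpenImmersion j]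
    (Z : Closeds X) :
    (vanishingIdeal Z).comap j = vanishingIdeal (Z.preimage j.continuous) := by
  apply eq_vanishingIdeal_of_radical
  · apply Scheme.IdealSheafData.ext
    funext V
    rw [radical_ideal, ideal_comap_of_isOpenImmersion, ← Ideal.comap_radical, vanishingIdeal_ideal,
      (PrimeSpectrum.isRadical_vanishingIdeal _).radical]
  · rw [support_comap]
    ext1
    rw [Closeds.coe_preimage, coe_support_vanishingIdeal, Closeds.coe_preimage]

/-- Germs along an open immersion: `germ_V ∘ (j^*)_V = j^*_y ∘ germ_{j(V)}` for an open
`V ∋ y` of `U`, where `(j^*)_V : Γ(X, j(V)) ≅ Γ(U, V)`. [folklore] -/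
theorem germ_comp_appIso_hom (j : U ⟶ X) [IsOpenImmersion j] (V : U.Opens) (y : U)
    (hy : y ∈ V) :
    (j.appIso V).hom ≫ U.presheaf.germ V y hy =
      X.presheaf.germ (j ''ᵁ V) (j y) ⟨y, hy, rfl⟩ ≫ j.stalkMap y := by
  rw [Scheme.Hom.germ_stalkMap j (j ''ᵁ V) y ⟨y, hy, rfl⟩, Scheme.Hom.appIso_hom, Category.assoc,
    TopCat.Presheaf.germ_res]

/-- **Stalks of pulled-back ideal sheaves along an open immersion** `j : U → X`:
`(𝒥|_U)_y = 𝒥_{j y} · 𝒪_{U,y}` along the isomorphism `j^*_y : 𝒪_{X,j y} ≅ 𝒪_{U,y}`. [folklore] -/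
theorem stalkIdeal_comap_of_isOpenImmersion (j : U ⟶ X) [IsOpenImmersion j]
    (𝒥 : X.IdealSheafData) (y : U) :
    stalkIdeal (𝒥.comap j) y = (stalkIdeal 𝒥 (j y)).map (j.stalkMap y).hom := by
  obtain ⟨_, ⟨V, hV, rfl⟩, hyV, -⟩ :=
    U.isBasis_affineOpens.exists_subset_of_mem_open (Set.mem_univ y) isOpen_univ
  have hW : IsAffineOpen (j ''ᵁ V) := hV.image_of_isOpenImmersion j
  have hyW : j y ∈ j ''ᵁ V := ⟨y, hyV, rfl⟩
  rw [stalkIdeal_eq_map_germ _ ⟨V, hV⟩ hyV, stalkIdeal_eq_map_germ 𝒥 ⟨_, hW⟩ hyW,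
    ideal_comap_of_isOpenImmersion, Ideal.map_map]
  -- pulling back along the inverse of the isomorphism `Γ(X, j V) ≅ Γ(U, V)` is pushing forward
  have hc : (𝒥.ideal ⟨j ''ᵁ V, hW⟩).comap (j.appIso V).inv.hom =
      (𝒥.ideal ⟨j ''ᵁ V, hW⟩).map (j.appIso V).hom.hom := by
    have := Ideal.map_comap_of_equiv (I := 𝒥.ideal ⟨j ''ᵁ V, hW⟩)
      (j.appIso V).commRingCatIsoToRingEquiv
    exact this.symm
  rw [hc, Ideal.map_map]
  congr 1
  rw [← CommRingCat.hom_comp, ← CommRingCat.hom_comp, germ_comp_appIso_hom]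

/-! ## Strict normal crossings may be checked on an open cover -/

/-- **The local form of a strict normal crossings divisor is local for open immersions**: if
every point of the closed `Z ⊆ X` lies in the image of an open immersion `j : U → X` such that
`j⁻¹ Z` is a strict normal crossings divisor in `U`, then `Z` is a strict normal crossings
divisor in `X` (the data at `j y` are transported along `𝒪_{X,j y} ≅ 𝒪_{U,y}`, the ideal of `Z`
going to the ideal of `j⁻¹ Z`). [folklore] -/
theorem IsStrictNormalCrossingsDivisor.of_forall_exists_isOpenImmersion {Z : Set X}
    (hZ : IsClosed Z)
    (h : ∀ q ∈ Z, ∃ (U : Scheme.{u}) (j : U ⟶ X), IsOpenImmersion j ∧ q ∈ Set.range j ∧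
      IsStrictNormalCrossingsDivisor U (j ⁻¹' Z)) :
    IsStrictNormalCrossingsDivisor X Z := by
  classical
  rw [isStrictNormalCrossingsDivisor_iff_stalkIdeal]
  refine ⟨hZ, fun q hq => ?_⟩
  obtain ⟨U, j, hj, ⟨y, rfl⟩, hU⟩ := h q hq
  rw [isStrictNormalCrossingsDivisor_iff_stalkIdeal] at hU
  obtain ⟨hreg, r, e, x, y', hr, hdim, hspan, hI⟩ := hU.2 y hq
  -- `φ : 𝒪_{X, j y} ≅ 𝒪_{U, y}`
  let φ : X.presheaf.stalk (j y) ≃+* U.presheaf.stalk y :=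
    (asIso (j.stalkMap y)).commRingCatIsoToRingEquiv
  have hφ : (φ : X.presheaf.stalk (j y) →+* U.presheaf.stalk y) = (j.stalkMap y).hom := rfl
  haveI := hreg
  refine ⟨IsRegularLocalRing.of_ringEquiv φ.symm, r, e, φ.symm ∘ x, φ.symm ∘ y', hr, ?_, ?_, ?_⟩
  · rw [ringKrullDim_eq_of_ringEquiv φ, hdim]
  · have := congrArg (Ideal.map φ.symm) hspan
    rw [Ideal.map_span, Set.image_union, ← Set.range_comp, ← Set.range_comp,
      IsLocalRing.eq_maximalIdeal (Ideal.map_isMaximal_of_equiv φ.symm)] at this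
    exact this
  · -- the ideal of `Z` at `j y` is carried to the ideal of `j⁻¹ Z` at `y`
    have hcl : (⟨closure Z, isClosed_closure⟩ : Closeds X) = ⟨Z, hZ⟩ := Closeds.ext hZ.closure_eq
    have hcl' : (⟨closure (j ⁻¹' Z), isClosed_closure⟩ : Closeds U) =
        (⟨Z, hZ⟩ : Closeds X).preimage j.continuous := by
      apply Closeds.ext
      simp only [Closeds.coe_mk, Closeds.coe_preimage]
      exact (hZ.preimage j.continuous).closure_eq
    rw [hcl', ← comap_vanishingIdeal_of_isOpenImmersion, stalkIdeal_comap_of_isOpenImmersion,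
      ← hφ] at hI
    rw [hcl]
    have := congrArg (Ideal.map (φ.symm : U.presheaf.stalk y →+* X.presheaf.stalk (j y))) hI
    rw [Ideal.map_map, Ideal.map_span, Set.image_singleton, map_prod] at this
    simpa [Ideal.map_id] using this

/-- **Strict normal crossings on a coproduct**: if `αᵢ : Uᵢ → X` pull the closed `Z` back to
strict normal crossings divisors, so does `∐ αᵢ : ∐ Uᵢ → X`. [folklore] -/
theorem IsStrictNormalCrossingsDivisor.sigmaDesc {ι : Type u} (g : ι → Scheme.{u})
    (α : ∀ i, g i ⟶ X) {Z : Set X} (hZ : IsClosed Z)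
    (h : ∀ i, IsStrictNormalCrossingsDivisor (g i) (α i ⁻¹' Z)) :
    IsStrictNormalCrossingsDivisor (∐ g) (Sigma.desc α ⁻¹' Z) := by
  refine IsStrictNormalCrossingsDivisor.of_forall_exists_isOpenImmersion
    (hZ.preimage (Sigma.desc α).continuous) fun q _ => ?_
  obtain ⟨i, y, rfl⟩ := (sigmaOpenCover g).exists_eq q
  haveI : IsOpenImmersion (Sigma.ι g i) :=
    inferInstanceAs (IsOpenImmersion ((sigmaOpenCover g).f i))
  refine ⟨g i, Sigma.ι g i, inferInstance, ⟨y, rfl⟩, ?_⟩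
  have : (Sigma.ι g i ⁻¹' (Sigma.desc α ⁻¹' Z) : Set (g i)) = α i ⁻¹' Z := by
    rw [← Set.preimage_comp]
    congr 1
    funext z
    change (Sigma.ι g i ≫ Sigma.desc α) z = α i z
    rw [Sigma.ι_desc]
  rw [this]
  exact h i

/-! ## The pointwise (Stacks 0BSF) form of de Jong's definition -/

/-- **Stacks 0BSF ⇒ de Jong 1996, 2.4**: let `Z ⊆ X` be closed and suppose every `p ∈ Z` lies
in the image of an étale `e : U → X` such that `e⁻¹ Z` is a strict normal crossings divisor in
`U`. Then `Z` is a normal crossings divisor (`IsNormalCrossingsDivisor`): the coproduct of the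
chosen `U_p`, `p ∈ Z`, and of the open subscheme `X ∖ Z` is étale and surjective over `X`, and
the preimage of `Z` in it is a strict normal crossings divisor (empty on the last summand).
[cite: StacksProject, Tag 0BSF] -/
theorem IsNormalCrossingsDivisor.of_forall_exists_etale {Z : Set X} (hZ : IsClosed Z)
    (h : ∀ p ∈ Z, ∃ (U : Scheme.{u}) (e : U ⟶ X), Etale e ∧ p ∈ Set.range e ∧
      IsStrictNormalCrossingsDivisor U (e ⁻¹' Z)) :
    IsNormalCrossingsDivisor X Z := by
  classical
  choose U e he hmem hsnc using h
  -- the summands: `U_p` for `p ∈ Z`, and the open complement of `Z`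
  let V : X.Opens := ⟨Zᶜ, hZ.isOpen_compl⟩
  let g : ↥Z ⊕ PUnit.{u + 1} → Scheme.{u} := Sum.elim (fun p => U p.1 p.2) fun _ => (V : Scheme.{u})
  let α : ∀ i, g i ⟶ X := fun i =>
    match i with
    | Sum.inl p => e p.1 p.2
    | Sum.inr _ => V.ι
  have hα : ∀ i, Etale (α i) := fun i =>
    match i with
    | Sum.inl p => he p.1 p.2
    | Sum.inr _ => (inferInstance : Etale V.ι)
  refine ⟨∐ g, Sigma.desc α, IsZariskiLocalAtSource.sigmaDesc hα, ⟨fun x => ?_⟩,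
    IsStrictNormalCrossingsDivisor.sigmaDesc g α hZ fun i => ?_⟩
  · -- surjectivity
    by_cases hx : x ∈ Z
    · obtain ⟨u, hu⟩ := hmem x hx
      refine ⟨Sigma.ι g (Sum.inl ⟨x, hx⟩) u, ?_⟩
      rw [← Scheme.Hom.comp_apply, Sigma.ι_desc]
      exact hu
    · refine ⟨Sigma.ι g (Sum.inr PUnit.unit) (⟨x, hx⟩ : V), ?_⟩
      rw [← Scheme.Hom.comp_apply, Sigma.ι_desc]
      rfl
  · -- strict normal crossings on each summand
    match i with
    | Sum.inl p => exact hsnc p.1 p.2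
    | Sum.inr _ =>
      apply IsStrictNormalCrossingsDivisor.of_eq_empty
      ext v
      simp only [Set.mem_preimage, Set.mem_empty_iff_false, iff_false]
      exact v.2

/-- De Jong's definition (2.4: one surjective étale cover) and the pointwise one (Stacks 0BSF)
of a normal crossings divisor agree, for closed subsets. [cite: StacksProject, Tag 0BSF] -/
theorem isNormalCrossingsDivisor_iff_forall_exists_etale {Z : Set X} (hZ : IsClosed Z) :
    IsNormalCrossingsDivisor X Z ↔ ∀ p ∈ Z, ∃ (U : Scheme.{u}) (e : U ⟶ X), Etale e ∧
      p ∈ Set.range e ∧ IsStrictNormalCrossingsDivisor U (e ⁻¹' Z) := by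
  refine ⟨fun h p _ => ?_, IsNormalCrossingsDivisor.of_forall_exists_etale hZ⟩
  obtain ⟨X', e, he, hs, h'⟩ := h
  exact ⟨X', e, he, e.surjective p, h'⟩

/-- **Closed points suffice on a Jacobson scheme**: let `X` be a Jacobson scheme (e.g. locally
of finite type over a field) and `Z ⊆ X` closed; if every CLOSED point `p ∈ Z` lies in the image
of an étale `e : U → X` with `e⁻¹ Z` a strict normal crossings divisor in `U`, then `Z` is a
normal crossings divisor. Indeed the images of these étale (open) morphisms form an open set
containing the closed points of the closed set `Z`, hence all of `Z`. [folklore] -/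
theorem IsNormalCrossingsDivisor.of_forall_closedPoints_exists_etale [JacobsonSpace X]
    {Z : Set X} (hZ : IsClosed Z)
    (h : ∀ p ∈ Z, IsClosed ({p} : Set X) → ∃ (U : Scheme.{u}) (e : U ⟶ X), Etale e ∧
      p ∈ Set.range e ∧ IsStrictNormalCrossingsDivisor U (e ⁻¹' Z)) :
    IsNormalCrossingsDivisor X Z := by
  classical
  apply IsNormalCrossingsDivisor.of_forall_exists_etale hZ
  intro p hp
  -- the union `W` of the images of the neighbourhoods of the closed points of `Z`
  choose U e he hmem hsnc using h
  let W : Set X := ⋃ q : {q : X // q ∈ Z ∧ IsClosed ({q} : Set X)}, Set.range (e q.1 q.2.1 q.2.2)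
  have hW : IsOpen W := by
    refine isOpen_iUnion fun q => ?_
    haveI := he q.1 q.2.1 q.2.2
    exact (e q.1 q.2.1 q.2.2).isOpenMap.isOpen_range
  -- `Z ⊆ W`: otherwise the closed `Z ∖ W` contains a closed point of `X`
  have hZW : Z ⊆ W := by
    by_contra hZW
    obtain ⟨z, hzZ, hzW⟩ := Set.not_subset.mp hZW
    obtain ⟨q, ⟨hqZ, hqW⟩, hq⟩ := nonempty_inter_closedPoints (Z := Z ∩ Wᶜ) ⟨z, hzZ, hzW⟩
      (hZ.inter hW.isClosed_compl).isLocallyClosed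
    exact hqW (Set.mem_iUnion.mpr ⟨⟨q, hqZ, hq⟩, hmem q hqZ hq⟩)
  obtain ⟨q, hq⟩ := Set.mem_iUnion.mp (hZW hp)
  exact ⟨U q.1 q.2.1 q.2.2, e q.1 q.2.1 q.2.2, he q.1 q.2.1 q.2.2, hq, hsnc q.1 q.2.1 q.2.2⟩

end Literature.AlgebraicGeometry.Resolution

end
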